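import Summits.QuantumFields.YangMills.Theorems.LuscherReductionDressedRitzPolyakovLiftChannelUniversality
import HarnessLib

/-!
# Sketch (GEN 1) — crux-ideate #1 on `LuscherReduction.DressedRitz` (stmt-QuantumFields-20205), idea «static-matching», RE-HOMED ON r5

Skeleton of record r5 `8b6782afbcc2a19a`: the load-bearing fine-side stub is S-UNIV′ `stub_universality : ∀ k, ChannelUniversalityAt k`
(fine dressed flowed-Polyakov channel numbers vs their one-site SHADOW at `B = 2L³/λ³`, clauses (A5) ∧ (A6′), scale-free).  GEN 0 cut the r3 node
S-POS; this file cuts S-UNIV′ along the same axis (coupling VALUE ∕ effective-theory FORM):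

* `ScaleU k` — STATIC SCALAR at the label: every lifted eigen-ratio built from a one-site basis at `B₁ = 2/λ³` has fine vacuum variance
  `1 ± C·λ` (time 0; the renormalisation condition; ALL β-function content — in particular the two-loop coefficient `b₁` — sits here);
* `ShapeU k C` — FORM, reparametrisation-invariant: at ANY trial parameter `lam' ∈ [λ/2, 2λ]`, static match at `lam'` (∀ basis at `2/lam'³`) ⇒ the
  r5 universality body (A5) ∧ (A6′) at `lam'` (basis at `2/lam'³`, shadow at `2L³/lam'³`, tolerances `e^{C'lam'²/L}`, `C'lam'²/L`).  No coefficient of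
  any running is inside: its truth value is invariant under `lam' ↦ lam'(1 + O(lam'))`.

`channelUniversality_of_scale_shape : (∀ k, ScaleU k) → (∀ k C, 0 ≤ C → ShapeU k C) → ∀ k, ChannelUniversalityAt k` is PROVED (modus ponens at
`lam' := λ(β,L)`; at the label `siteCouplingAt`, `liftCouplingAt`, `ChannelBodyAt` ARE the tree's objects by `rfl`).  Nothing is proposed to the
tree and no registered stub is touched; the typed pieces are offered to the LEAD for the re-cut S-STAT″ := S-STAT ∧ ScaleU, S-UNIV″ := ShapeU.
-/

set_option autoImplicit false

noncomputable section

open MeasureTheory Real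
open Literature.MathematicalPhysics.QuantumFieldTheory (GaugeConfig)
open scoped BigOperators

namespace Summit.QuantumFields.YangMills.Cruxes.DressedRitz.StaticMatching

open Summit.QuantumFields.YangMills.Theorems.FemtoTransferGap
open Summit.QuantumFields.YangMills.Theorems.FemtoTransferGap.PolyakovLift

/-- One-site coupling at the BOX scale for a trial Lüscher parameter `lam'`: `B(lam') = 2L³/lam'³`. -/
def siteCouplingAt (lam' : ℝ) (L : ℕ) : ℝ := 2 * (L : ℝ) ^ 3 / lam' ^ 3

/-- One-site coupling at the POLYAKOV scale for a trial parameter `lam'`: `B₁(lam') = 2/lam'³`. -/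
def liftCouplingAt (lam' : ℝ) : ℝ := 2 / lam' ^ 3

theorem siteCouplingAt_label (β : ℝ) (L : ℕ) : siteCouplingAt (luscherLambda β L) L = oneSiteCoupling β L := rfl

theorem liftCouplingAt_label (β : ℝ) (L : ℕ) : liftCouplingAt (luscherLambda β L) = liftCoupling β L := rfl

/-- STATIC MATCH at trial parameter `lam'` (time 0, one-slice vacuum law): every UNDRESSED lifted eigen-ratio `liftVec β φ g_i` (one-site basis
at `B₁(lam')`, flowed Polyakov insertion on the raw vacuum `φ`, `‖φ‖ = 1`) has vacuum variance in `[1 − C·lam', 1 + C·lam']` (one-site value: `1`).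
A renormalisation CONDITION: deliberately normalisation-sensitive, well-posed because `IsRawVacuum` and `LiftBasis` fix all norms. -/
def StaticMatchAt {L : ℕ} [NeZero L] {k : ℕ} (lam' C : ℝ) (β : ℝ) (φ : GaugeConfig 3 L SU2 → ℝ)
    (g : Fin k → (GaugeConfig 3 1 SU2 → ℝ)) : Prop :=
  ∀ i : Fin k, |l2 (liftVec β φ (g i)) (liftVec β φ (g i)) - 1| ≤ C * lam'

/-- The r5 universality BODY (A5) ∧ (A6′) at trial parameter `lam'`: verbatim `ChannelUniversalityAt` with `oneSiteCoupling β L ↦ siteCouplingAt lam' L`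
and `luscherLambda β L ↦ lam'` (degree-0 homogeneous in each family, as in r5). -/
def ChannelBodyAt (lam' : ℝ) (k : ℕ) (C : ℝ) {L : ℕ} [NeZero L] (β : ℝ)
    (u : Fin k → (GaugeConfig 3 L SU2 → ℝ)) (w : Fin k → (GaugeConfig 3 1 SU2 → ℝ)) : Prop :=
  (∀ i : Fin k,
    l2 (u i) (transferApply β (u i)) * l2 (w i) (w i) * levelValue su2Rep 1 (siteCouplingAt lam' L) 0 ≤
        Real.exp (C * lam' ^ 2 / L) *
          (l2 (w i) (transferApply (siteCouplingAt lam' L) (w i)) * l2 (u i) (u i) * levelValue su2Rep L β 0) ∧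
    l2 (w i) (transferApply (siteCouplingAt lam' L) (w i)) * l2 (u i) (u i) * levelValue su2Rep L β 0 ≤
        Real.exp (C * lam' ^ 2 / L) *
          (l2 (u i) (transferApply β (u i)) * l2 (w i) (w i) * levelValue su2Rep 1 (siteCouplingAt lam' L) 0)) ∧
  (∀ i l : Fin k, i ≠ l →
    |(l2 (u i) (transferApply β (u l)) -
        (l2 (u i) (transferApply β (u i)) / l2 (u i) (u i) + l2 (u l) (transferApply β (u l)) / l2 (u l) (u l)) / 2 *
          l2 (u i) (u l)) * levelValue su2Rep 1 (siteCouplingAt lam' L) 0 * (Real.sqrt (l2 (w i) (w i)) * Real.sqrt (l2 (w l) (w l))) -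
      (l2 (w i) (transferApply (siteCouplingAt lam' L) (w l)) -
        (l2 (w i) (transferApply (siteCouplingAt lam' L) (w i)) / l2 (w i) (w i) +
            l2 (w l) (transferApply (siteCouplingAt lam' L) (w l)) / l2 (w l) (w l)) / 2 * l2 (w i) (w l)) * levelValue su2Rep L β 0 *
        (Real.sqrt (l2 (u i) (u i)) * Real.sqrt (l2 (u l) (u l)))|
      ≤ C * (lam' ^ 2 / L) * levelValue su2Rep L β 0 * levelValue su2Rep 1 (siteCouplingAt lam' L) 0 *
        (Real.sqrt (l2 (u i) (u i)) * Real.sqrt (l2 (u l) (u l))) * (Real.sqrt (l2 (w i) (w i)) * Real.sqrt (l2 (w l) (w l))))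

/-- SCALE (static scalar = the running coupling): the static match holds AT THE LABEL `λ(β,L)` for every one-site eigen-ratio basis at `2/λ³`.
(Identical to GEN 0's `ScaleS`.)  This is where two-loop asymptotic scaling of one finite-volume static observable lives. -/
def ScaleU (k : ℕ) : Prop :=
  ∃ C lam0 : ℝ, 0 ≤ C ∧ 0 < lam0 ∧ ∀ lam : ℝ, 0 < lam → lam ≤ lam0 → ∃ L0 : ℕ,
    ∀ (L : ℕ) [NeZero L], L0 ≤ L → ∀ β : ℝ, InFemtoWindow lam β L →
      ∀ φ : GaugeConfig 3 L SU2 → ℝ, IsRawVacuum β φ →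
        ∀ (ω : GaugeConfig 3 1 SU2 → ℝ) (g : Fin k → (GaugeConfig 3 1 SU2 → ℝ)), LiftBasis (liftCoupling β L) k ω g →
          StaticMatchAt (luscherLambda β L) C β φ g

/-- SHAPE = FORM of the effective theory (answers to a static-match constant `C`): for every `lam' ∈ [λ/2, 2λ]`, IF every basis at `B₁(lam')` is
statically matched at `lam'`, THEN for every basis at `B₁(lam')` and every one-site raw vacuum at `B(lam')` the r5 body holds at `lam'`. -/
def ShapeU (k : ℕ) (C : ℝ) : Prop :=
  ∃ C' lam0 : ℝ, 0 ≤ C' ∧ 0 < lam0 ∧ ∀ lam : ℝ, 0 < lam → lam ≤ lam0 → ∃ L0 : ℕ,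
    ∀ (L : ℕ) [NeZero L], L0 ≤ L → ∀ β : ℝ, InFemtoWindow lam β L →
      ∀ φ : GaugeConfig 3 L SU2 → ℝ, IsRawVacuum β φ →
        ∀ lam' : ℝ, luscherLambda β L / 2 ≤ lam' → lam' ≤ 2 * luscherLambda β L →
          (∀ (ω : GaugeConfig 3 1 SU2 → ℝ) (g : Fin k → (GaugeConfig 3 1 SU2 → ℝ)),
              LiftBasis (liftCouplingAt lam') k ω g → StaticMatchAt lam' C β φ g) →
          ∀ (ω : GaugeConfig 3 1 SU2 → ℝ) (g : Fin k → (GaugeConfig 3 1 SU2 → ℝ)), LiftBasis (liftCouplingAt lam') k ω g →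
            ∀ e₀ : GaugeConfig 3 1 SU2 → ℝ, IsRawVacuum (L := 1) (siteCouplingAt lam' L) e₀ →
              ChannelBodyAt lam' k C' β (dressedLiftFamily β φ g) (shadowFamily (siteCouplingAt lam' L) L e₀ g)

/-- At the label the parametrised body IS the r5 clause body (definitional). -/
theorem channelUniversalityAt_iff_label (k : ℕ) :
    ChannelUniversalityAt k ↔
      ∃ C lam0 : ℝ, 0 ≤ C ∧ 0 < lam0 ∧ ∀ lam : ℝ, 0 < lam → lam ≤ lam0 → ∃ L0 : ℕ,
        ∀ (L : ℕ) [NeZero L], L0 ≤ L → ∀ β : ℝ, InFemtoWindow lam β L →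
          ∀ φ : GaugeConfig 3 L SU2 → ℝ, IsRawVacuum β φ →
            ∀ (ω : GaugeConfig 3 1 SU2 → ℝ) (g : Fin k → (GaugeConfig 3 1 SU2 → ℝ)), LiftBasis (liftCoupling β L) k ω g →
              ∀ e₀ : GaugeConfig 3 1 SU2 → ℝ, IsRawVacuum (L := 1) (oneSiteCoupling β L) e₀ →
                ChannelBodyAt (luscherLambda β L) k C β (dressedLiftFamily β φ g) (shadowFamily (oneSiteCoupling β L) L e₀ g) :=
  Iff.rfl

/-- ★ FIRST LEMMA (glue, proved): SCALE ∧ FORM ⇒ S-UNIV′ (`∀ k, ChannelUniversalityAt k` = the registered `Stmt.stub_universality` of r5),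
by modus ponens at `lam' := λ(β,L)`. -/
theorem channelUniversality_of_scale_shape (hScale : ∀ k, ScaleU k) (hShape : ∀ k C, 0 ≤ C → ShapeU k C) :
    ∀ k, ChannelUniversalityAt k := by
  intro k
  obtain ⟨C, lam0, hC, hlam0, hS⟩ := hScale k
  obtain ⟨C', lam0', hC', hlam0', hSh⟩ := hShape k C hC
  rw [channelUniversalityAt_iff_label]
  refine ⟨C', min lam0 lam0', hC', lt_min hlam0 hlam0', ?_⟩
  intro lam hlam hle
  obtain ⟨L0, hL0⟩ := hS lam hlam (le_trans hle (min_le_left _ _))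
  obtain ⟨L0', hL0'⟩ := hSh lam hlam (le_trans hle (min_le_right _ _))
  refine ⟨max L0 L0', ?_⟩
  intro L _ hL β hβ φ hφ ω g hωg e₀ he₀
  have h1 := hL0 L (le_trans (le_max_left _ _) hL) β hβ φ hφ
  have h2 := hL0' L (le_trans (le_max_right _ _) hL) β hβ φ hφ (luscherLambda β L)
  have hpos : 0 < luscherLambda β L := luscherLambda_pos_of_window hlam hβ
  have hlo : luscherLambda β L / 2 ≤ luscherLambda β L := by linarith
  have hhi : luscherLambda β L ≤ 2 * luscherLambda β L := by linarith
  exact h2 hlo hhi (fun ω' g' hω'g' => h1 ω' g' hω'g') ω g hωg e₀ he₀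

/-- The same glue, stated against the r5 stub text `Stmt.stub_universality := ∀ k, ChannelUniversalityAt k` (re-homed character for character). -/
abbrev Stmt_stub_universality : Prop := ∀ k : ℕ, ChannelUniversalityAt k

theorem stub_universality_of_scale_shape (hScale : ∀ k, ScaleU k) (hShape : ∀ k C, 0 ≤ C → ShapeU k C) :
    Stmt_stub_universality :=
  channelUniversality_of_scale_shape hScale hShape

/-- Downstream check: SCALE ∧ FORM ∧ S-PSCAL ⇒ the r3 position text `LiftPositionR3` (tree `liftPositionR3_of_channelUniversality_pscalingExists`). -/
theorem liftPositionR3_of_scale_shape_pscaling (hScale : ∀ k, ScaleU k) (hShape : ∀ k C, 0 ≤ C → ShapeU k C)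
    (hB : ∀ k, PScalingExistsAt k) : LiftPositionR3 :=
  liftPositionR3_of_channelUniversality_pscalingExists (channelUniversality_of_scale_shape hScale hShape) hB

/-! ## The L-ladder of SCALE at fixed `lam` (loop-order ledger, typed): three regimes, one literature class each

* tier 0 `log L ≤ 1/(16 b₀ lam²)`      — NO β-function coefficient is visible at the clause precision (label = bare parameter ± λ², GEN 0 rung
  `SubWindowLabel`; the running `2b₀g₀² log L ≤ λ/8` is itself inside the `O(λ)` slack): pure UV stability + bounded one-loop width correction;
* tier 1 `1/(16 b₀ lam²) < log L ≤ exp(1/lam²)` — `b₀` exact, `b₁` invisible (the two-loop term moves `1/ḡ²` by `(b₁/b₀)·log(β/2b₀) = O(1/lam²)`,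
  relative effect on `λ` `O(lam)`): one-loop asymptotic scaling of one static observable;
* tier 2 `exp(1/lam²) < log L`          — `b₀` AND `b₁` exact (the `log log L` drift is unbounded): two-loop asymptotic scaling.
`scaleU_of_tiers` glues the three restricted statements back to `ScaleU k` (exact cover; constants `max`, thresholds `min`/`max`). -/

/-- SCALE restricted to a regime `R lam L`. -/
def ScaleUOn (R : ℝ → ℕ → Prop) (k : ℕ) : Prop :=
  ∃ C lam0 : ℝ, 0 ≤ C ∧ 0 < lam0 ∧ ∀ lam : ℝ, 0 < lam → lam ≤ lam0 → ∃ L0 : ℕ,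
    ∀ (L : ℕ) [NeZero L], L0 ≤ L → R lam L → ∀ β : ℝ, InFemtoWindow lam β L →
      ∀ φ : GaugeConfig 3 L SU2 → ℝ, IsRawVacuum β φ →
        ∀ (ω : GaugeConfig 3 1 SU2 → ℝ) (g : Fin k → (GaugeConfig 3 1 SU2 → ℝ)), LiftBasis (liftCoupling β L) k ω g →
          StaticMatchAt (luscherLambda β L) C β φ g

/-- tier 0: the sub-window (no running visible). -/
def tier0 (lam : ℝ) (L : ℕ) : Prop := Real.log L ≤ 1 / (16 * b0 * lam ^ 2)

/-- tier 1: one-loop running visible, two-loop not. -/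
def tier1 (lam : ℝ) (L : ℕ) : Prop := 1 / (16 * b0 * lam ^ 2) < Real.log L ∧ Real.log L ≤ Real.exp (1 / lam ^ 2)

/-- tier 2: the doubly-exponential tail (two-loop running visible). -/
def tier2 (lam : ℝ) (L : ℕ) : Prop := Real.exp (1 / lam ^ 2) < Real.log L

theorem tier_cover (lam : ℝ) (L : ℕ) : tier0 lam L ∨ tier1 lam L ∨ tier2 lam L := by
  unfold tier0 tier1 tier2
  rcases le_or_gt (Real.log L) (1 / (16 * b0 * lam ^ 2)) with h | h
  · exact Or.inl h
  · rcases le_or_gt (Real.log L) (Real.exp (1 / lam ^ 2)) with h' | h'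
    · exact Or.inr (Or.inl ⟨h, h'⟩)
    · exact Or.inr (Or.inr h')

/-- `StaticMatchAt` is monotone in its constant (for `0 ≤ lam'`). -/
theorem staticMatchAt_mono {L : ℕ} [NeZero L] {k : ℕ} {lam' C C'' : ℝ} {β : ℝ} {φ : GaugeConfig 3 L SU2 → ℝ}
    {g : Fin k → (GaugeConfig 3 1 SU2 → ℝ)} (h : StaticMatchAt lam' C β φ g) (hC : C ≤ C'') (hl : 0 ≤ lam') :
    StaticMatchAt lam' C'' β φ g :=
  fun i => (h i).trans (mul_le_mul_of_nonneg_right hC hl)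

/-- ★ The three tiers glue back to SCALE (exact cover). -/
theorem scaleU_of_tiers {k : ℕ} (h0 : ScaleUOn tier0 k) (h1 : ScaleUOn tier1 k) (h2 : ScaleUOn tier2 k) : ScaleU k := by
  obtain ⟨C0, l0, hC0, hl0, H0⟩ := h0
  obtain ⟨C1, l1, hC1, hl1, H1⟩ := h1
  obtain ⟨C2, l2', hC2, hl2, H2⟩ := h2
  refine ⟨max C0 (max C1 C2), min l0 (min l1 l2'), le_max_of_le_left hC0, lt_min hl0 (lt_min hl1 hl2), ?_⟩
  intro lam hlam hle
  obtain ⟨L0, hL0⟩ := H0 lam hlam (hle.trans (min_le_left _ _))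
  obtain ⟨L1, hL1⟩ := H1 lam hlam (hle.trans ((min_le_right _ _).trans (min_le_left _ _)))
  obtain ⟨L2, hL2⟩ := H2 lam hlam (hle.trans ((min_le_right _ _).trans (min_le_right _ _)))
  refine ⟨max L0 (max L1 L2), ?_⟩
  intro L _ hL β hβ φ hφ ω g hωg
  have hpos : 0 ≤ luscherLambda β L := (luscherLambda_pos_of_window hlam hβ).le
  rcases tier_cover lam L with t | t | t
  · exact staticMatchAt_mono (hL0 L ((le_max_left _ _).trans hL) t β hβ φ hφ ω g hωg) (le_max_left _ _) hpos
  · exact staticMatchAt_mono (hL1 L (((le_max_left _ _).trans (le_max_right _ _)).trans hL) t β hβ φ hφ ω g hωg)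
      ((le_max_left _ _).trans (le_max_right _ _)) hpos
  · exact staticMatchAt_mono (hL2 L (((le_max_right _ _).trans (le_max_right _ _)).trans hL) t β hβ φ hφ ω g hωg)
      ((le_max_right _ _).trans (le_max_right _ _)) hpos

end Summit.QuantumFields.YangMills.Cruxes.DressedRitz.StaticMatching
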